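import Summits.QuantumFields.YangMills.Theorems.UnitScaleTiltProp8FlatOpsHRowsFromKernels
import HarnessLib

/-!
# Route `UnitScaleTilt`, crux K1 child «MinimiserStabilityRegPr» (stmt-QuantumFields-19200), stub H `stub_halvingStep`, the (165)-A₁ row's dressing letter `C_E`:
# **WANTED №g26-1 (X2-CH) — THE `∂^{η*}∂^η`-PAIRING LETTER OF `H`**: `|⟨∂^{η*}∂^η(HX), Z⟩| ≤ B_CH·s·Σ_c u(c)|X(c)|` for a FIELD `Z` whose gradient letter is `≤ s`,
# **FROM THE KERNEL ROW (k2) ((2.151)₂) AND ONE TRANSPOSED COLUMN SUM** — by ONE integration by parts `⟨∂*∂(HX), Z⟩ = ⟨∂(HX), ∂Z⟩` (no (137), no (2.149), no sup letter of `Z`)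

Cell `ym3-torus` (HUMAN RULING D-0037, YM ladder rung R3), width seat `ym-ust-19936-w3` gen 4 (★★OWNER ym3-torus-plan g26 ASSIGNMENTS 10 (b)∕11: (X2-CH) → this seat; WEIGHT OF
RECORD `u(c) = η⁻³(L^{j(c)}η)⁻¹`, `v(b) = (w 3 b)⁻¹`, ★w8-19200∕★w8-19936 2026-08-28T05:11Z).  `--supports stmt-QuantumFields-19200 --as helper`; count-neutral; def-free.
Serves item 19936 `HistoryTailL` only through its (T) row (T8 ⇐ {H, EX}).

THE PRINT.  [Balaban1985Variational] (88) p. 291, second and third terms: the dressing gradient `E₂ = −T_{A′}ᵀ[½(∂*∂)_c(ΨA′)]` is estimated by moving `∂*∂H` to the other side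
of the pairing; print routes it through [5] (3.132) on `QZ`.  Here the same letter comes from the cheaper identity `⟨∂*∂(HX), Z⟩ = ⟨∂(HX), ∂Z⟩` on the η-lattice
([Balaban1984PropagatorsI] (1.2), (1.21): `∂*` is the adjoint of `∂`; the tree's `B6SectAOperatorsV1.inner_dcsE_left`), the gradient kernel row (2.151)₂ of
[Balaban1984PropagatorsII] Cor. 2.8 (`HKernelRows` (k2): `(Lʲ⁽ᵇ⁾η)·η⁻¹·|(He_c)(b+e_ν) − (He_c)(b)| ≤ C·e^{−δd(b,c)}`), the gradient letter of the field `Z`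
(`(Lʲ⁽ᵇ⁾η)²·η⁻¹·|Z(b+e_ν) − Z(b)| ≤ s`, the second half of (46)∕(152)), and the TRANSPOSED column sum `Σ_b (w₃(b))⁻¹e^{−δ′d(b,c)} ≤ K₀·u(c)` (fine bonds against an index
bond: `≤ 3·L^{3j′}` bonds per `j′`-block against `(L^{j′}η)⁻³` = `3η⁻³` per block, then Lemma 2.1 (2.61) — the row ★w8-19200 g0 displays for (X2-H); discharged at the
port distance in the companion concrete files).

WHAT IS PROVED (sorry-free; axioms standard; no definition).  For every nested family `D`, P2 weights `w` (`IsLevWeight`), distance `dBI ≥ 0`, plain-function `H`: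
* §1 `levWeight_pos`, `levWeight_dir` (the weights are positive and depend on `b.src` only), `levWeight_three` (`w₃ = w₁·w₂`);
  ★ `abs_curl_le_of_gradLetter` — `w₂(x)·|(∂_{η⁻¹}Z)(p)| ≤ 2s` at every plaquette `p` with corner `x` from the gradient letter of `Z`;
  ★ `abs_curl_le_of_row2` — `w₁(x)·|(∂_{η⁻¹}(He_c))(p)| ≤ C·(e^{−δd(⟨x,ν⟩,c)} + e^{−δd(⟨x,μ⟩,c)})` from (k2);
* §2 `sum_plaq_fst_le`, `sum_plaq_snd_le` — a nonnegative bond function summed over `p ↦ ⟨p.src, p.μ⟩` (resp. `p.ν`) is `≤ d·Σ_b` (injection `p ↦ (bond, other direction)`);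
  `sum_dcsE_dcE_mul_eq` — `Σ_b (∂*∂u)(b)·Z(b) = Σ_p (∂u)(p)·(∂Z)(p)`;
* §3 ★★ **`curlCurlPairing_of_row2`** — (X2-CH): from (k2) at `(C, δ)` and `hcol : ∀ c, Σ_b (w 3 b)⁻¹·e^{−δ′·dBI(b,c)} ≤ K₀·u(c)` (`δ′ ≤ δ`):
  `∀ Z s, 0 ≤ s → (∀ b ν, w 2 b·L^{K−n}·|Z(b+ν) − Z(b)| ≤ s) → ∀ X, |Σ_b (∂^{η*}∂^η(HX))(b)·Z(b)| ≤ (4·d·C·K₀)·s·Σ_c u(c)·|X(c)|` (`d = (F.P K).d = 3`);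
  ★★ **`curlCurlPairing_of_kernelRows`** — the same from `HKernelRows … dBI w H C δ`.
HONEST SCOPE: finite sums, linearity, one summation by parts; no estimate proved here; the column sum is a displayed row (its discharge at every `Adm22` datum is the
(X1)-concrete method, `…FlatPortCurlCurlSupRowL0.plainRowSum_domT` + the bonds-per-block count — ★w8-19200 g0's `…ChartHInvColumnLetter` or a twin of this seat).
For the chart-H of record `HX = flatHᴹX̃′ + dφ` the `dφ` summand drops out of this letter exactly (`∂(dφ) = 0`).  NOT a claim about the mass gap.  YM₃ on the three-torus is
rung R3 of the programme, not the Clay problem.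

References: T. Bałaban, CMP **102** (1985) 277–309 [Balaban1985Variational] (46) p.285, (85)–(89) pp.290–291, (152) p.301, (161)–(163) p.303; CMP **95** (1984) 17–40
[Balaban1984PropagatorsI] (1.2) p.18, (1.21) p.21; CMP **96** (1984) 223–250 [Balaban1984PropagatorsII] Lemma 2.1 (2.61) p.234, Cor. 2.8 (2.150)–(2.151) p.249.
-/

set_option autoImplicit false

noncomputable section

open scoped BigOperators InnerProductSpace

namespace Summit.QuantumFields.YangMills.Theorems.FlatHCurlCurlPairing

open Literature.MathematicalPhysics.QuantumFieldTheory.Balaban1983to89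
open Literature.MathematicalPhysics.QuantumFieldTheory.BalabanImbrieJaffe1984to88.BIJ85AxialPropagator411 (BondSpace PlaqSpace)
open LatticeFieldCalculus (curl)
open B6SectADomainsV1 (Domains)
open B6SectAOperatorsV1 (BondIdx dcE dcsE curlFn inner_eq_sum inner_dcsE_left dcE_apply)
open T3ContinuumYM3Torus (T3Family)
open FlatCubeOpsText (IsLevWeight)
open FlatOpsHRowsFromKernels (HKernelRows apply_eq_sum_indicator exists_indicator)

/-! ## §1 The weights; the two per-plaquette bounds -/

section Weights

variable {F : T3Family} {n K : ℕ} {D : Domains (F.P K)} {w : ℕ → PBond (F.P K) 0 → ℝ}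

/-- the level weights are positive. [cite: Balaban1985Variational, p.286] -/
theorem levWeight_pos (hw : IsLevWeight F n K D w) (m : ℕ) (b : PBond (F.P K) 0) : 0 < w m b := by
  have hL0 : (0 : ℝ) < (F.L : ℝ) := by exact_mod_cast lt_trans zero_lt_one F.hL.2
  rw [hw m b]
  positivity

/-- the level weights depend on the bond's source only: `w m ⟨x, μ⟩ = w m ⟨x, ν⟩`. [cite: Balaban1985Variational, p.286, (152) p.301] -/
theorem levWeight_dir (hw : IsLevWeight F n K D w) (m : ℕ) (x : Site (F.P K) 0) (μ ν : Fin (F.P K).d) : w m ⟨x, μ⟩ = w m ⟨x, ν⟩ := by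
  rw [hw m ⟨x, μ⟩, hw m ⟨x, ν⟩]

/-- `w₃ = w₁·w₂`. [cite: Balaban1985Variational, p.286] -/
theorem levWeight_three (hw : IsLevWeight F n K D w) (b : PBond (F.P K) 0) : w 3 b = w 1 b * w 2 b := by
  rw [hw 3 b, hw 1 b, hw 2 b]; ring

/-- ★ **THE CURL OF A FIELD FROM ITS GRADIENT LETTER**: if `w₂(b)·η⁻¹·|Z(b+e_ν) − Z(b)| ≤ s` for all `b, ν`, then at every plaquette `p` with corner `x`:
`w₂(x)·|(∂_{η⁻¹}Z)(p)| ≤ 2s` (the plaquette variable is the difference of two forward differences at bonds with source `x`).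
[cite: Balaban1984PropagatorsI, (1.2) p.18; Balaban1985Variational, (46) p.285, (152) p.301] -/
theorem abs_curl_le_of_gradLetter (hw : IsLevWeight F n K D w) {Z : PBond (F.P K) 0 → ℝ} {s : ℝ}
    (hZ : ∀ (b : PBond (F.P K) 0) (ν : Fin (F.P K).d), w 2 b * (F.L : ℝ) ^ (K - n) * |Z ⟨b.src.shift ν, b.dir⟩ - Z b| ≤ s) (p : Plaq (F.P K) 0) :
    w 2 ⟨p.src, p.μ⟩ * |curl ((F.L : ℝ) ^ (K - n)) Z p| ≤ 2 * s := by
  have hc : (0 : ℝ) ≤ (F.L : ℝ) ^ (K - n) := pow_nonneg (Nat.cast_nonneg _) _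
  have h1 := hZ ⟨p.src, p.ν⟩ p.μ
  have h2 := hZ ⟨p.src, p.μ⟩ p.ν
  rw [levWeight_dir hw 2 p.src p.ν p.μ] at h1
  have hw2 : 0 ≤ w 2 ⟨p.src, p.μ⟩ := (levWeight_pos hw 2 _).le
  have e : curl ((F.L : ℝ) ^ (K - n)) Z p =
      (F.L : ℝ) ^ (K - n) * (Z ⟨p.src.shift p.μ, p.ν⟩ - Z ⟨p.src, p.ν⟩) - (F.L : ℝ) ^ (K - n) * (Z ⟨p.src.shift p.ν, p.μ⟩ - Z ⟨p.src, p.μ⟩) := by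
    unfold curl; rw [smul_eq_mul]; ring
  rw [e]
  calc w 2 ⟨p.src, p.μ⟩ * |(F.L : ℝ) ^ (K - n) * (Z ⟨p.src.shift p.μ, p.ν⟩ - Z ⟨p.src, p.ν⟩) -
          (F.L : ℝ) ^ (K - n) * (Z ⟨p.src.shift p.ν, p.μ⟩ - Z ⟨p.src, p.μ⟩)|
      ≤ w 2 ⟨p.src, p.μ⟩ * (|(F.L : ℝ) ^ (K - n) * (Z ⟨p.src.shift p.μ, p.ν⟩ - Z ⟨p.src, p.ν⟩)| +
          |(F.L : ℝ) ^ (K - n) * (Z ⟨p.src.shift p.ν, p.μ⟩ - Z ⟨p.src, p.μ⟩)|) := mul_le_mul_of_nonneg_left (abs_sub _ _) hw2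
    _ = w 2 ⟨p.src, p.μ⟩ * (F.L : ℝ) ^ (K - n) * |Z ⟨p.src.shift p.μ, p.ν⟩ - Z ⟨p.src, p.ν⟩| +
          w 2 ⟨p.src, p.μ⟩ * (F.L : ℝ) ^ (K - n) * |Z ⟨p.src.shift p.ν, p.μ⟩ - Z ⟨p.src, p.μ⟩| := by
        rw [abs_mul, abs_mul, abs_of_nonneg hc]; ring
    _ ≤ s + s := add_le_add h1 h2
    _ = 2 * s := by ring

variable {dBI : PBond (F.P K) 0 → BondIdx D → ℝ} {H : (BondIdx D → ℝ) →ₗ[ℝ] (PBond (F.P K) 0 → ℝ)}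

/-- ★ **THE CURL OF A KERNEL COLUMN FROM ROW (k2)**: if `w₁(b)·η⁻¹·|(He_c)(b+e_ν) − (He_c)(b)| ≤ C·e^{−δd(b,c)}` for all `b, ν`, then at every plaquette `p` with corner `x`:
`w₁(x)·|(∂_{η⁻¹}(He_c))(p)| ≤ C·(e^{−δd(⟨x,p.ν⟩,c)} + e^{−δd(⟨x,p.μ⟩,c)})`. [cite: Balaban1984PropagatorsII, Cor. 2.8 (2.151) p.249; Balaban1984PropagatorsI, (1.2) p.18] -/
theorem abs_curl_le_of_row2 (hw : IsLevWeight F n K D w) {C δ : ℝ} {e : BondIdx D → ℝ} {c : BondIdx D}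
    (hk2 : ∀ (b : PBond (F.P K) 0) (ν : Fin (F.P K).d),
      w 1 b * (F.L : ℝ) ^ (K - n) * |H e ⟨b.src.shift ν, b.dir⟩ - H e b| ≤ C * Real.exp (-(δ * dBI b c)))
    (p : Plaq (F.P K) 0) :
    w 1 ⟨p.src, p.μ⟩ * |curl ((F.L : ℝ) ^ (K - n)) (H e) p| ≤
      C * (Real.exp (-(δ * dBI ⟨p.src, p.ν⟩ c)) + Real.exp (-(δ * dBI ⟨p.src, p.μ⟩ c))) := by
  have hc : (0 : ℝ) ≤ (F.L : ℝ) ^ (K - n) := pow_nonneg (Nat.cast_nonneg _) _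
  have h1 := hk2 ⟨p.src, p.ν⟩ p.μ
  have h2 := hk2 ⟨p.src, p.μ⟩ p.ν
  rw [levWeight_dir hw 1 p.src p.ν p.μ] at h1
  have hw1 : 0 ≤ w 1 ⟨p.src, p.μ⟩ := (levWeight_pos hw 1 _).le
  have e' : curl ((F.L : ℝ) ^ (K - n)) (H e) p =
      (F.L : ℝ) ^ (K - n) * (H e ⟨p.src.shift p.μ, p.ν⟩ - H e ⟨p.src, p.ν⟩) - (F.L : ℝ) ^ (K - n) * (H e ⟨p.src.shift p.ν, p.μ⟩ - H e ⟨p.src, p.μ⟩) := by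
    unfold curl; rw [smul_eq_mul]; ring
  rw [e']
  calc w 1 ⟨p.src, p.μ⟩ * |(F.L : ℝ) ^ (K - n) * (H e ⟨p.src.shift p.μ, p.ν⟩ - H e ⟨p.src, p.ν⟩) -
          (F.L : ℝ) ^ (K - n) * (H e ⟨p.src.shift p.ν, p.μ⟩ - H e ⟨p.src, p.μ⟩)|
      ≤ w 1 ⟨p.src, p.μ⟩ * (|(F.L : ℝ) ^ (K - n) * (H e ⟨p.src.shift p.μ, p.ν⟩ - H e ⟨p.src, p.ν⟩)| +
          |(F.L : ℝ) ^ (K - n) * (H e ⟨p.src.shift p.ν, p.μ⟩ - H e ⟨p.src, p.μ⟩)|) := mul_le_mul_of_nonneg_left (abs_sub _ _) hw1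
    _ = w 1 ⟨p.src, p.μ⟩ * (F.L : ℝ) ^ (K - n) * |H e ⟨p.src.shift p.μ, p.ν⟩ - H e ⟨p.src, p.ν⟩| +
          w 1 ⟨p.src, p.μ⟩ * (F.L : ℝ) ^ (K - n) * |H e ⟨p.src.shift p.ν, p.μ⟩ - H e ⟨p.src, p.μ⟩| := by
        rw [abs_mul, abs_mul, abs_of_nonneg hc]; ring
    _ ≤ C * Real.exp (-(δ * dBI ⟨p.src, p.ν⟩ c)) + C * Real.exp (-(δ * dBI ⟨p.src, p.μ⟩ c)) := add_le_add h1 h2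
    _ = C * (Real.exp (-(δ * dBI ⟨p.src, p.ν⟩ c)) + Real.exp (-(δ * dBI ⟨p.src, p.μ⟩ c))) := by ring

end Weights

/-! ## §2 Plaquettes → bonds; the summation by parts -/

section Sums

variable {P : Params}

/-- a nonnegative bond function summed over `p ↦ ⟨p.src, p.μ⟩` is at most `d` times its bond sum (the map `p ↦ (⟨p.src, p.μ⟩, p.ν)` is injective). [folklore] -/
theorem sum_plaq_fst_le {f : PBond P 0 → ℝ} (hf : ∀ b, 0 ≤ f b) : ∑ p : Plaq P 0, f ⟨p.src, p.μ⟩ ≤ (P.d : ℝ) * ∑ b, f b := by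
  classical
  set ι : Plaq P 0 → PBond P 0 × Fin P.d := fun p => (⟨p.src, p.μ⟩, p.ν) with hι
  have hinj : Function.Injective ι := by
    intro p q h
    obtain ⟨ps, pμ, pν, ph⟩ := p
    obtain ⟨qs, qμ, qν, qh⟩ := q
    simp only [hι, Prod.mk.injEq, PBond.mk.injEq] at h
    obtain ⟨⟨rfl, rfl⟩, rfl⟩ := h
    rfl
  have h1 : ∑ p : Plaq P 0, f ⟨p.src, p.μ⟩ = ∑ q ∈ Finset.univ.image ι, f q.1 := by
    rw [Finset.sum_image fun p _ q _ h => hinj h]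
  rw [h1]
  calc ∑ q ∈ Finset.univ.image ι, f q.1 ≤ ∑ q : PBond P 0 × Fin P.d, f q.1 :=
        Finset.sum_le_sum_of_subset_of_nonneg (Finset.subset_univ _) fun q _ _ => hf q.1
    _ = ∑ b : PBond P 0, ∑ _ν : Fin P.d, f b := Fintype.sum_prod_type _
    _ = (P.d : ℝ) * ∑ b, f b := by
        rw [Finset.mul_sum]
        exact Finset.sum_congr rfl fun b _ => by rw [Finset.sum_const, Finset.card_univ, Fintype.card_fin, nsmul_eq_mul]

/-- the same for `p ↦ ⟨p.src, p.ν⟩` (injection `p ↦ (⟨p.src, p.ν⟩, p.μ)`). [folklore] -/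
theorem sum_plaq_snd_le {f : PBond P 0 → ℝ} (hf : ∀ b, 0 ≤ f b) : ∑ p : Plaq P 0, f ⟨p.src, p.ν⟩ ≤ (P.d : ℝ) * ∑ b, f b := by
  classical
  set ι : Plaq P 0 → PBond P 0 × Fin P.d := fun p => (⟨p.src, p.ν⟩, p.μ) with hι
  have hinj : Function.Injective ι := by
    intro p q h
    obtain ⟨ps, pμ, pν, ph⟩ := p
    obtain ⟨qs, qμ, qν, qh⟩ := q
    simp only [hι, Prod.mk.injEq, PBond.mk.injEq] at h
    obtain ⟨⟨rfl, rfl⟩, rfl⟩ := h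
    rfl
  have h1 : ∑ p : Plaq P 0, f ⟨p.src, p.ν⟩ = ∑ q ∈ Finset.univ.image ι, f q.1 := by
    rw [Finset.sum_image fun p _ q _ h => hinj h]
  rw [h1]
  calc ∑ q ∈ Finset.univ.image ι, f q.1 ≤ ∑ q : PBond P 0 × Fin P.d, f q.1 :=
        Finset.sum_le_sum_of_subset_of_nonneg (Finset.subset_univ _) fun q _ _ => hf q.1
    _ = ∑ b : PBond P 0, ∑ _ν : Fin P.d, f b := Fintype.sum_prod_type _
    _ = (P.d : ℝ) * ∑ b, f b := by
        rw [Finset.mul_sum]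
        exact Finset.sum_congr rfl fun b _ => by rw [Finset.sum_const, Finset.card_univ, Fintype.card_fin, nsmul_eq_mul]

/-- **SUMMATION BY PARTS**: `Σ_b (∂*∂u)(b)·Z(b) = Σ_p (∂u)(p)·(∂Z)(p)` (`∂*` is the adjoint of `∂` for the plain ℓ² pairings).
[cite: Balaban1984PropagatorsI, (1.2) p.18, (1.21) p.21; Balaban1984PropagatorsII, (2.18) p.226] -/
theorem sum_dcsE_dcE_mul_eq (cf : ℝ) (u : PBond P 0 → ℝ) (Z : PBond P 0 → ℝ) :
    ∑ b, (dcsE (P := P) cf (dcE cf (WithLp.toLp 2 u))) b * Z b = ∑ p : Plaq P 0, curl cf u p * curl cf Z p := by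
  have h : ∑ b, (dcsE (P := P) cf (dcE cf (WithLp.toLp 2 u))) b * Z b = ⟪dcsE (P := P) cf (dcE cf (WithLp.toLp 2 u)), WithLp.toLp 2 Z⟫_ℝ := by
    rw [inner_eq_sum]
  rw [h, inner_dcsE_left, inner_eq_sum]
  rfl

end Sums

/-! ## §3 (X2-CH): the `∂^{η*}∂^η`-pairing letter -/

section Pairing

variable {F : T3Family} {n K : ℕ} {D : Domains (F.P K)} {w : ℕ → PBond (F.P K) 0 → ℝ}
variable {dBI : PBond (F.P K) 0 → BondIdx D → ℝ} {H : (BondIdx D → ℝ) →ₗ[ℝ] (PBond (F.P K) 0 → ℝ)}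

/-- ★★ **(X2-CH) — THE `∂^{η*}∂^η`-PAIRING LETTER OF `H` FROM ROW (k2) AND THE TRANSPOSED COLUMN SUM**: if `w₁(b)·η⁻¹·|(He_c)(b+e_ν) − (He_c)(b)| ≤ C·e^{−δ·dBI(b,c)}` for every
indicator `e_c` (`C ≥ 0`), and `Σ_b (w 3 b)⁻¹·e^{−δ′·dBI(b,c)} ≤ K₀·u(c)` for every index bond (`δ′ ≤ δ`, `dBI ≥ 0`), then for every field `Z` with gradient letter `≤ s` (`s ≥ 0`)
and every index datum `X`: `|Σ_b (∂^{η*}∂^η(HX))(b)·Z(b)| ≤ (4·d·C·K₀)·s·Σ_c u(c)·|X(c)|`.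
[cite: Balaban1985Variational, (88) p.291, (161)-(163) p.303; Balaban1984PropagatorsII, Cor. 2.8 (2.151) p.249, Lemma 2.1 (2.61) p.234; Balaban1984PropagatorsI, (1.2) p.18, (1.21) p.21] -/
theorem curlCurlPairing_of_row2 (hw : IsLevWeight F n K D w) {C K₀ δ' δ : ℝ} {u : BondIdx D → ℝ} (hC : 0 ≤ C) (hδ' : δ' ≤ δ)
    (hd0 : ∀ b c, 0 ≤ dBI b c)
    (hk2 : ∀ (c : BondIdx D) (e : BondIdx D → ℝ), e c = 1 → (∀ c', c' ≠ c → e c' = 0) → ∀ (b : PBond (F.P K) 0) (ν : Fin (F.P K).d),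
      w 1 b * (F.L : ℝ) ^ (K - n) * |H e ⟨b.src.shift ν, b.dir⟩ - H e b| ≤ C * Real.exp (-(δ * dBI b c)))
    (hcol : ∀ c : BondIdx D, ∑ b : PBond (F.P K) 0, (w 3 b)⁻¹ * Real.exp (-(δ' * dBI b c)) ≤ K₀ * u c) :
    ∀ (Z : PBond (F.P K) 0 → ℝ) (s : ℝ), 0 ≤ s →
      (∀ (b : PBond (F.P K) 0) (ν : Fin (F.P K).d), w 2 b * (F.L : ℝ) ^ (K - n) * |Z ⟨b.src.shift ν, b.dir⟩ - Z b| ≤ s) →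
      ∀ X : BondIdx D → ℝ,
        |∑ b, (dcsE ((F.L : ℝ) ^ (K - n)) (dcE ((F.L : ℝ) ^ (K - n)) (WithLp.toLp 2 (H X)))) b * Z b| ≤
          (4 * ((F.P K).d : ℝ) * C * K₀) * s * ∑ c, u c * |X c| := by
  intro Z s hs hZ X
  set cf : ℝ := (F.L : ℝ) ^ (K - n) with hcf
  obtain ⟨e, he, he'⟩ := exists_indicator (ι := BondIdx D)
  -- the column function of the index bond `c` at rate `δ′`
  set f : BondIdx D → PBond (F.P K) 0 → ℝ := fun c b => (w 3 b)⁻¹ * Real.exp (-(δ' * dBI b c)) with hf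
  have hf0 : ∀ c b, 0 ≤ f c b := fun c b => mul_nonneg (inv_nonneg.2 (levWeight_pos hw 3 b).le) (Real.exp_pos _).le
  have hexp : ∀ b c, Real.exp (-(δ * dBI b c)) ≤ Real.exp (-(δ' * dBI b c)) := fun b c =>
    Real.exp_le_exp.2 (neg_le_neg (mul_le_mul_of_nonneg_right hδ' (hd0 b c)))
  -- summation by parts and linearity of `X ↦ (∂(HX))(p)`
  rw [sum_dcsE_dcE_mul_eq]
  set T : (BondIdx D → ℝ) →ₗ[ℝ] (Plaq (F.P K) 0 → ℝ) := curlFn (P := F.P K) cf ∘ₗ H with hT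
  have hTapp : ∀ (Y : BondIdx D → ℝ) (p : Plaq (F.P K) 0), curl cf (H Y) p = T Y p := fun _ _ => rfl
  -- the per-plaquette bound for each indicator column
  have hplaq : ∀ (c : BondIdx D) (p : Plaq (F.P K) 0),
      |T (e c) p| * |curl cf Z p| ≤ 2 * C * s * (f c ⟨p.src, p.ν⟩ + f c ⟨p.src, p.μ⟩) := by
    intro c p
    have hw1 : 0 < w 1 ⟨p.src, p.μ⟩ := levWeight_pos hw 1 _
    have hw2 : 0 < w 2 ⟨p.src, p.μ⟩ := levWeight_pos hw 2 _
    have hw3 : w 3 ⟨p.src, p.μ⟩ = w 1 ⟨p.src, p.μ⟩ * w 2 ⟨p.src, p.μ⟩ := levWeight_three hw _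
    have hA : w 1 ⟨p.src, p.μ⟩ * |T (e c) p| ≤ C * (Real.exp (-(δ * dBI ⟨p.src, p.ν⟩ c)) + Real.exp (-(δ * dBI ⟨p.src, p.μ⟩ c))) := by
      rw [← hTapp]; exact abs_curl_le_of_row2 hw (hk2 c (e c) (he c) (he' c)) p
    have hB : w 2 ⟨p.src, p.μ⟩ * |curl cf Z p| ≤ 2 * s := abs_curl_le_of_gradLetter hw hZ p
    have hprod : w 3 ⟨p.src, p.μ⟩ * (|T (e c) p| * |curl cf Z p|) ≤
        C * (Real.exp (-(δ * dBI ⟨p.src, p.ν⟩ c)) + Real.exp (-(δ * dBI ⟨p.src, p.μ⟩ c))) * (2 * s) := by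
      rw [hw3]
      calc w 1 ⟨p.src, p.μ⟩ * w 2 ⟨p.src, p.μ⟩ * (|T (e c) p| * |curl cf Z p|)
          = (w 1 ⟨p.src, p.μ⟩ * |T (e c) p|) * (w 2 ⟨p.src, p.μ⟩ * |curl cf Z p|) := by ring
        _ ≤ C * (Real.exp (-(δ * dBI ⟨p.src, p.ν⟩ c)) + Real.exp (-(δ * dBI ⟨p.src, p.μ⟩ c))) * (2 * s) :=
            mul_le_mul hA hB (mul_nonneg hw2.le (abs_nonneg _)) (by positivity)
    -- divide by `w₃(x)` and pass to rate `δ′`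
    have hw3pos : 0 < w 3 ⟨p.src, p.μ⟩ := levWeight_pos hw 3 _
    have hdiv : |T (e c) p| * |curl cf Z p| ≤
        (w 3 ⟨p.src, p.μ⟩)⁻¹ * (C * (Real.exp (-(δ * dBI ⟨p.src, p.ν⟩ c)) + Real.exp (-(δ * dBI ⟨p.src, p.μ⟩ c))) * (2 * s)) := by
      rw [le_inv_mul_iff₀ hw3pos]; exact hprod
    have hwν : (w 3 ⟨p.src, p.ν⟩)⁻¹ = (w 3 ⟨p.src, p.μ⟩)⁻¹ := by rw [levWeight_dir hw 3 p.src p.ν p.μ]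
    calc |T (e c) p| * |curl cf Z p|
        ≤ (w 3 ⟨p.src, p.μ⟩)⁻¹ * (C * (Real.exp (-(δ * dBI ⟨p.src, p.ν⟩ c)) + Real.exp (-(δ * dBI ⟨p.src, p.μ⟩ c))) * (2 * s)) := hdiv
      _ ≤ (w 3 ⟨p.src, p.μ⟩)⁻¹ * (C * (Real.exp (-(δ' * dBI ⟨p.src, p.ν⟩ c)) + Real.exp (-(δ' * dBI ⟨p.src, p.μ⟩ c))) * (2 * s)) :=
          mul_le_mul_of_nonneg_left (mul_le_mul_of_nonneg_right (mul_le_mul_of_nonneg_left (add_le_add (hexp _ c) (hexp _ c)) hC) (by positivity))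
            (inv_nonneg.2 hw3pos.le)
      _ = 2 * C * s * (f c ⟨p.src, p.ν⟩ + f c ⟨p.src, p.μ⟩) := by simp only [hf]; rw [hwν]; ring
  -- the column sums over plaquettes
  have hcolP : ∀ c : BondIdx D, ∑ p : Plaq (F.P K) 0, (f c ⟨p.src, p.ν⟩ + f c ⟨p.src, p.μ⟩) ≤ 2 * ((F.P K).d : ℝ) * (K₀ * u c) := by
    intro c
    rw [Finset.sum_add_distrib]
    have h1 := sum_plaq_snd_le (P := F.P K) (f := f c) (hf0 c)
    have h2 := sum_plaq_fst_le (P := F.P K) (f := f c) (hf0 c)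
    have hd : (0 : ℝ) ≤ ((F.P K).d : ℝ) := Nat.cast_nonneg _
    have h3 : ((F.P K).d : ℝ) * ∑ b, f c b ≤ ((F.P K).d : ℝ) * (K₀ * u c) := mul_le_mul_of_nonneg_left (hcol c) hd
    linarith
  -- expand `T X = Σ_c X(c)·T e_c` and sum
  have hTX : ∀ p, T X p = ∑ c, X c * T (e c) p := fun p => apply_eq_sum_indicator T e he he' X p
  calc |∑ p : Plaq (F.P K) 0, curl cf (H X) p * curl cf Z p|
      ≤ ∑ p : Plaq (F.P K) 0, |curl cf (H X) p * curl cf Z p| := Finset.abs_sum_le_sum_abs _ _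
    _ = ∑ p : Plaq (F.P K) 0, |∑ c, X c * T (e c) p| * |curl cf Z p| := Finset.sum_congr rfl fun p _ => by rw [abs_mul, hTapp, hTX]
    _ ≤ ∑ p : Plaq (F.P K) 0, (∑ c, |X c| * |T (e c) p|) * |curl cf Z p| := Finset.sum_le_sum fun p _ => by
        refine mul_le_mul_of_nonneg_right ((Finset.abs_sum_le_sum_abs _ _).trans (le_of_eq ?_)) (abs_nonneg _)
        exact Finset.sum_congr rfl fun c _ => abs_mul _ _
    _ = ∑ p : Plaq (F.P K) 0, ∑ c, |X c| * (|T (e c) p| * |curl cf Z p|) := Finset.sum_congr rfl fun p _ => by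
        rw [Finset.sum_mul]; exact Finset.sum_congr rfl fun c _ => by ring
    _ = ∑ c, |X c| * ∑ p : Plaq (F.P K) 0, |T (e c) p| * |curl cf Z p| := by
        rw [Finset.sum_comm]; exact Finset.sum_congr rfl fun c _ => by rw [Finset.mul_sum]
    _ ≤ ∑ c, |X c| * (2 * C * s * (2 * ((F.P K).d : ℝ) * (K₀ * u c))) := Finset.sum_le_sum fun c _ => by
        refine mul_le_mul_of_nonneg_left ?_ (abs_nonneg _)
        calc ∑ p : Plaq (F.P K) 0, |T (e c) p| * |curl cf Z p|
            ≤ ∑ p : Plaq (F.P K) 0, 2 * C * s * (f c ⟨p.src, p.ν⟩ + f c ⟨p.src, p.μ⟩) := Finset.sum_le_sum fun p _ => hplaq c p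
          _ = 2 * C * s * ∑ p : Plaq (F.P K) 0, (f c ⟨p.src, p.ν⟩ + f c ⟨p.src, p.μ⟩) := by rw [Finset.mul_sum]
          _ ≤ 2 * C * s * (2 * ((F.P K).d : ℝ) * (K₀ * u c)) := mul_le_mul_of_nonneg_left (hcolP c) (by positivity)
    _ = (4 * ((F.P K).d : ℝ) * C * K₀) * s * ∑ c, u c * |X c| := by
        rw [Finset.mul_sum]; exact Finset.sum_congr rfl fun c _ => by ring

/-- ★★ **(X2-CH) FROM THE KERNEL ROWS OF RECORD**: `HKernelRows … dBI w H C δ` (its (k2) conjunct) and the transposed column sum give the `∂^{η*}∂^η`-pairing letter.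
[cite: Balaban1985Variational, (88) p.291, (161)-(163) p.303; Balaban1984PropagatorsII, Cor. 2.8 (2.150)-(2.151) p.249, Lemma 2.1 (2.61) p.234] -/
theorem curlCurlPairing_of_kernelRows (hw : IsLevWeight F n K D w) {C K₀ δ' δ : ℝ} {u : BondIdx D → ℝ} (hC : 0 ≤ C) (hδ' : δ' ≤ δ)
    (hd0 : ∀ b c, 0 ≤ dBI b c) (hk : HKernelRows F n K D dBI w H C δ)
    (hcol : ∀ c : BondIdx D, ∑ b : PBond (F.P K) 0, (w 3 b)⁻¹ * Real.exp (-(δ' * dBI b c)) ≤ K₀ * u c) :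
    ∀ (Z : PBond (F.P K) 0 → ℝ) (s : ℝ), 0 ≤ s →
      (∀ (b : PBond (F.P K) 0) (ν : Fin (F.P K).d), w 2 b * (F.L : ℝ) ^ (K - n) * |Z ⟨b.src.shift ν, b.dir⟩ - Z b| ≤ s) →
      ∀ X : BondIdx D → ℝ,
        |∑ b, (dcsE ((F.L : ℝ) ^ (K - n)) (dcE ((F.L : ℝ) ^ (K - n)) (WithLp.toLp 2 (H X)))) b * Z b| ≤
          (4 * ((F.P K).d : ℝ) * C * K₀) * s * ∑ c, u c * |X c| :=
  curlCurlPairing_of_row2 hw hC hδ' hd0 (fun c e he he' b ν => (hk c e he he' b).2.1 ν) hcol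

end Pairing

end Summit.QuantumFields.YangMills.Theorems.FlatHCurlCurlPairing

end
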